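import Summits.ResolutionOfSingularities.ResolutionOfSingularities.Theorems.FrobeniusLadderFInjectiveMacaulayficationPointFloorNotFullCI
import Summits.ResolutionOfSingularities.ResolutionOfSingularities.Theorems.FrobeniusLadderFInjectiveMacaulayficationMonicTowerPrime
import Summits.ResolutionOfSingularities.ResolutionOfSingularities.Theorems.FrobeniusLadderFInjectiveMacaulayficationDiagonalBPCIVertexNotFull
import HarnessLib

/-!
# BED CI-1 — THE FLOOR NOT-FULL COLUMN: for EVERY blowing up of `Spec 𝒪_{X,v}` along the point floor, `X = V(x₀²+x₁³+x₂³+x₃⁴+x₄⁵+x₅⁵, x₀²+2x₁³+3x₂³+4x₃⁴+5x₄⁵+6x₅⁵) ⊂ 𝔸⁶`,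
# some stalk over the closed point is NOT FULL — for every prime `p` with `3 ≠ 0` in `k`, `k` ANY field (the `x₅`-chart of `Bl_𝔪 X` is the MONIC TOWER
# `(y₀² − G₅, y₁³ + H₅)`, `G₅, H₅ ∈ k[y₂..y₅]`, and its origin fails the CI Fedder test p-UNIFORMLY)
# (crux `FInjectiveMacaulayfication` stmt-ResolutionOfSingularities-15315, chain w45a; res-L1-w45a-plan-1 RULING R23.11 (2) «FLOOR columns = CI twins of `PointFloorLegalOfIsolated` /
# `PointFloorNotFullOfFedder` … here `(g₁, h)` with `θF₂ − θF₁ = x₅h`»; seat res-L1-w45a-stub-2 g13)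

[OURS · L1 W4.5a] Support file (`--supports stmt-ResolutionOfSingularities-15315 --as helper`); def-free; UNCONDITIONAL; no named fact, no sorry; NOT a statement of any
manuscript; replaces the role of NO printed item. Nothing of the crux is proved. AI-written (AI review weaker than expert review).

THE CHART. With `P = 2F₁ − F₂ = x₀² − G`, `Q = F₂ − F₁ = x₁³ + H` (`G = x₂³+2x₃⁴+3x₄⁵+4x₅⁵`, `H = 2x₂³+3x₃⁴+4x₄⁵+5x₅⁵`) and the chart substitution `θ₅ : xⱼ ↦ yⱼy₅ (j ≠ 5)`:
`θ₅P = y₅²·p₁`, `θ₅Q = y₅³·q₁` with `p₁ = y₀² − G₅`, `q₁ = y₁³ + H₅`, `G₅ = y₅y₂³ + 2y₅²y₃⁴ + 3y₅³y₄⁵ + 4y₅³`, `H₅ = 2y₂³ + 3y₅y₃⁴ + 4y₅²y₄⁵ + 5y₅²` — again a MONIC TOWER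
with coefficients in `C = k[y₂, y₃, y₄, y₅]`.
* §1 `theta_P`, `theta_Q`, `theta_F` — the chart identities (`θ₅F₁ = y₅²p₁ + y₅³q₁`, `θ₅F₂ = y₅²p₁ + 2y₅³q₁`); `P_mem`, `Q_mem`.
* §2 `no_square_G₅` (specialise `y₂ ↦ t², y₅ ↦ t`: `t⁷ + 4t³`, odd degree — no hypothesis on `k`), `no_cube_H₅` (specialise `y₃, y₅ ↦ t`: `3t⁵ + 5t²`, degree `5` when `3 ≠ 0`);
  ★ `isPrime_chart5` — `J₅ = (p₁, q₁)` is PRIME and `y₅ ∉ J₅` (✓ `MonicTowerPrime.isPrime_span_tower`), i.e. `(p₁, q₁)` IS the strict transform (saturated w.r.t. `y₅`).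
* §3 ★ `prod_pow_mem_span_X_pow_chart5` — THE p-UNIFORM CI FEDDER CERTIFICATE AT THE CHART ORIGIN: `(p₁q₁)^{p−1} ∈ (y₀^p, …, y₅^p)` for every `p ≥ 2` (weights `(18, 8, 8, 3, 0, 12)`:
  `p₁`, `q₁` weighted-homogeneous of weights `36`, `24`; `60 > 49 = Σ wᵢ`); `sop_certificate_chart5` — `(y)⁴ ⊆ (p₁, q₁, y₂, y₃, y₄, y₅)`.
* §4 ★★ `diagonalBPCI_pointFloor_not_full` — for every blowing up `g : S′ → Spec 𝒪_{X,v}` along `𝔪̃|`: `∃ s ∈ S′` over the closed point with `¬ FullCl p (𝒪_{S′,s})` — ONE application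
  of ✓ `PointFloorNotFullCI.pointFloor_not_full`. Hypothesis: `(3 : k) ≠ 0` (only for the specialisation certifying primality of the chart ideal); the Fedder part is p-uniform.
[cite: Fedder1983, Thm. 1.12 and Prop. 2.1] [cite: StacksProject, Tag 0804] [cite: GortzWedhorn2020, Prop. 13.91 (2)]
-/

-- single-problem summit: the doubled namespace component is forced
set_option linter.dupNamespace false

noncomputable section

open AlgebraicGeometry MvPolynomial IsLocalRing

namespace Summit.ResolutionOfSingularities.ResolutionOfSingularities.Theorems.FInjectiveMacaulayfication.DiagonalBPCIChart5NotFull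

open Summit.ResolutionOfSingularities.ResolutionOfSingularities.Theorems.FInjectiveMacaulayfication SliceableCentre
open Literature.AlgebraicGeometry.Resolution

variable (k : Type) [Field k]

/-! ## §1 The chart identities -/

section Chart

variable (F : Fin 2 → MvPolynomial (Fin 6) k)
  (hF0 : F 0 = X 0 ^ 2 + X 1 ^ 3 + X 2 ^ 3 + X 3 ^ 4 + X 4 ^ 5 + X 5 ^ 5)
  (hF1 : F 1 = X 0 ^ 2 + C 2 * X 1 ^ 3 + C 3 * X 2 ^ 3 + C 4 * X 3 ^ 4 + C 5 * X 4 ^ 5 + C 6 * X 5 ^ 5)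
  (g : Fin 2 → MvPolynomial (Fin 6) k)
  (hg0 : g 0 = X 0 ^ 2 - (X 5 * X 2 ^ 3 + C 2 * X 5 ^ 2 * X 3 ^ 4 + C 3 * X 5 ^ 3 * X 4 ^ 5 + C 4 * X 5 ^ 3))
  (hg1 : g 1 = X 1 ^ 3 + (C 2 * X 2 ^ 3 + C 3 * X 5 * X 3 ^ 4 + C 4 * X 5 ^ 2 * X 4 ^ 5 + C 5 * X 5 ^ 2))
include hF0 hF1 hg0 hg1

set_option linter.unusedSimpArgs false in
-- one `simp only` set serves both chart identities; not every lemma fires in each case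
/-- ★ **The chart identities**: `θ₅(2F₁ − F₂) = y₅²·p₁`, `θ₅(F₂ − F₁) = y₅³·q₁`. [folklore] -/
theorem theta_PQ : ∀ l : Fin 2,
    aeval (fun j : Fin 6 => if j = 5 then (X 5 : MvPolynomial (Fin 6) k) else X j * X 5) ((![C 2 * F 0 - F 1, F 1 - F 0] : Fin 2 → MvPolynomial (Fin 6) k) l) =
      X 5 ^ ((![2, 3] : Fin 2 → ℕ) l) * g l := by
  refine Fin.forall_fin_two.mpr ⟨?_, ?_⟩
  · simp only [Matrix.cons_val_zero, hF0, hF1, hg0]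
    simp only [map_sub, map_add, map_mul, map_pow, aeval_X, aeval_C, algebraMap_eq, Fin.reduceEq, if_true, if_false, map_ofNat, reduceIte]
    ring
  · simp only [Matrix.cons_val_one, Matrix.cons_val_zero, hF0, hF1, hg1]
    simp only [map_sub, map_add, map_mul, map_pow, aeval_X, aeval_C, algebraMap_eq, Fin.reduceEq, if_true, if_false, map_ofNat, reduceIte]
    ring

set_option linter.unusedSimpArgs false in
-- one `simp only` set serves both generators; not every lemma fires in each case
/-- **The total transforms lie in the chart ideal**: `θ₅F₁ = y₅²p₁ + y₅³q₁`, `θ₅F₂ = y₅²p₁ + 2y₅³q₁ ∈ (p₁, q₁)`. [folklore] -/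
theorem theta_F_mem : ∀ l : Fin 2,
    aeval (fun j : Fin 6 => if j = 5 then (X 5 : MvPolynomial (Fin 6) k) else X j * X 5) (F l) ∈ Ideal.span (Set.range g) := by
  have h0 : g 0 ∈ Ideal.span (Set.range g) := Ideal.subset_span ⟨0, rfl⟩
  have h1 : g 1 ∈ Ideal.span (Set.range g) := Ideal.subset_span ⟨1, rfl⟩
  refine Fin.forall_fin_two.mpr ⟨?_, ?_⟩
  · have e : aeval (fun j : Fin 6 => if j = 5 then (X 5 : MvPolynomial (Fin 6) k) else X j * X 5) (F 0) = X 5 ^ 2 * g 0 + X 5 ^ 3 * g 1 := by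
      rw [hF0, hg0, hg1]
      simp only [map_sub, map_add, map_mul, map_pow, aeval_X, aeval_C, algebraMap_eq, Fin.reduceEq, if_true, if_false, map_ofNat, reduceIte]
      ring
    rw [e]
    exact add_mem (Ideal.mul_mem_left _ _ h0) (Ideal.mul_mem_left _ _ h1)
  · have e : aeval (fun j : Fin 6 => if j = 5 then (X 5 : MvPolynomial (Fin 6) k) else X j * X 5) (F 1) = X 5 ^ 2 * g 0 + C 2 * X 5 ^ 3 * g 1 := by
      rw [hF1, hg0, hg1]
      simp only [map_sub, map_add, map_mul, map_pow, aeval_X, aeval_C, algebraMap_eq, Fin.reduceEq, if_true, if_false, map_ofNat, reduceIte]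
      ring
    rw [e]
    exact add_mem (Ideal.mul_mem_left _ _ h0) (Ideal.mul_mem_left _ _ h1)

omit hF0 hF1 hg0 hg1 in
/-- `P = 2F₁ − F₂`, `Q = F₂ − F₁` lie in `(F₁, F₂)`. [plumbing] -/
theorem PQ_mem : ∀ l : Fin 2, ((![C 2 * F 0 - F 1, F 1 - F 0] : Fin 2 → MvPolynomial (Fin 6) k) l) ∈ Ideal.span (Set.range F) := by
  have h0 : F 0 ∈ Ideal.span (Set.range F) := Ideal.subset_span ⟨0, rfl⟩
  have h1 : F 1 ∈ Ideal.span (Set.range F) := Ideal.subset_span ⟨1, rfl⟩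
  refine Fin.forall_fin_two.mpr ⟨?_, ?_⟩
  · simp only [Matrix.cons_val_zero]
    exact sub_mem (Ideal.mul_mem_left _ _ h0) h1
  · simp only [Matrix.cons_val_one, Matrix.cons_val_zero]
    exact sub_mem h1 h0

omit hF0 hF1 in
/-- `p₁, q₁` vanish at the chart origin. [plumbing] -/
theorem constantCoeff_g : ∀ l : Fin 2, constantCoeff (g l) = 0 := by
  refine Fin.forall_fin_two.mpr ⟨?_, ?_⟩
  · rw [hg0]; simp [constantCoeff_X]
  · rw [hg1]; simp [constantCoeff_X]

end Chart

/-! ## §2 The chart ideal is the monic tower `(y₀² − G₅, y₁³ + H₅)`, hence prime with `y₅ ∉` it -/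

/-- `s(G₅) = t⁷ + 4t³` under `y₂ ↦ t²`, `y₅ ↦ t`, `y₃, y₄ ↦ 0` (`G₅ ∈ k[y₂, y₃, y₄, y₅]` written in `X 0, …, X 3`). [plumbing] -/
theorem spec_G₅ (G : MvPolynomial (Fin 4) k) (hG : G = X 3 * X 0 ^ 3 + C 2 * X 3 ^ 2 * X 1 ^ 4 + C 3 * X 3 ^ 3 * X 2 ^ 5 + C 4 * X 3 ^ 3) :
    MvPolynomial.eval₂Hom (Polynomial.C : k →+* Polynomial k) (![Polynomial.X ^ 2, 0, 0, Polynomial.X] : Fin 4 → Polynomial k) G =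
      Polynomial.X ^ 7 + Polynomial.C 4 * Polynomial.X ^ 3 := by
  rw [hG]
  simp only [map_add, map_mul, map_pow, MvPolynomial.eval₂Hom_X', MvPolynomial.eval₂Hom_C, Matrix.cons_val_zero, Matrix.cons_val_one,
    Matrix.cons_val]
  ring

/-- `s'(H₅) = 3t⁵ + 5t²` under `y₃ ↦ t`, `y₅ ↦ t`, `y₂, y₄ ↦ 0`. [plumbing] -/
theorem spec_H₅ (H : MvPolynomial (Fin 4) k) (hH : H = C 2 * X 0 ^ 3 + C 3 * X 3 * X 1 ^ 4 + C 4 * X 3 ^ 2 * X 2 ^ 5 + C 5 * X 3 ^ 2) :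
    MvPolynomial.eval₂Hom (Polynomial.C : k →+* Polynomial k) (![0, Polynomial.X, 0, Polynomial.X] : Fin 4 → Polynomial k) H =
      Polynomial.C 3 * Polynomial.X ^ 5 + Polynomial.C 5 * Polynomial.X ^ 2 := by
  rw [hH]
  simp only [map_add, map_mul, map_pow, MvPolynomial.eval₂Hom_X', MvPolynomial.eval₂Hom_C, Matrix.cons_val_zero, Matrix.cons_val_one,
    Matrix.cons_val]
  ring

/-- **`G₅` is not a square in `k[y₂..y₅]`** (`2·deg = 7` after specialisation; no hypothesis on `k`). [elementary] -/
theorem no_square_G₅ (G : MvPolynomial (Fin 4) k) (hG : G = X 3 * X 0 ^ 3 + C 2 * X 3 ^ 2 * X 1 ^ 4 + C 3 * X 3 ^ 3 * X 2 ^ 5 + C 4 * X 3 ^ 3)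
    (y : MvPolynomial (Fin 4) k) : y ^ 2 ≠ G := by
  intro h0
  have h1 := congrArg (MvPolynomial.eval₂Hom (Polynomial.C : k →+* Polynomial k) (![Polynomial.X ^ 2, 0, 0, Polynomial.X] : Fin 4 → Polynomial k)) h0
  rw [map_pow, spec_G₅ k G hG] at h1
  have hdeg : (Polynomial.X ^ 7 + Polynomial.C (4 : k) * Polynomial.X ^ 3).natDegree = 7 := by
    rw [Polynomial.natDegree_add_eq_left_of_degree_lt, Polynomial.natDegree_X_pow]
    rw [Polynomial.degree_X_pow]
    exact (Polynomial.degree_C_mul_X_pow_le 3 (4 : k)).trans_lt (by exact_mod_cast (by norm_num : (3 : ℕ) < 7))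
  have h2 := congrArg Polynomial.natDegree h1
  rw [Polynomial.natDegree_pow, hdeg] at h2
  omega

/-- **`−H₅` is not a cube in `k[y₂..y₅]`** when `3 ≠ 0` in `k` (`3·deg = 5` after specialisation). [elementary] -/
theorem no_cube_H₅ (h3 : (3 : k) ≠ 0) (H : MvPolynomial (Fin 4) k) (hH : H = C 2 * X 0 ^ 3 + C 3 * X 3 * X 1 ^ 4 + C 4 * X 3 ^ 2 * X 2 ^ 5 + C 5 * X 3 ^ 2)
    (y : MvPolynomial (Fin 4) k) : y ^ 3 + H ≠ 0 := by
  intro h0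
  have h1 := congrArg (MvPolynomial.eval₂Hom (Polynomial.C : k →+* Polynomial k) (![0, Polynomial.X, 0, Polynomial.X] : Fin 4 → Polynomial k)) h0
  rw [map_add, map_pow, spec_H₅ k H hH, map_zero] at h1
  have hdeg : (Polynomial.C (3 : k) * Polynomial.X ^ 5 + Polynomial.C 5 * Polynomial.X ^ 2).natDegree = 5 := by
    rw [Polynomial.natDegree_add_eq_left_of_degree_lt, Polynomial.natDegree_C_mul_X_pow 5 (3 : k) h3]
    rw [Polynomial.degree_C_mul_X_pow 5 h3]
    exact (Polynomial.degree_C_mul_X_pow_le 2 (5 : k)).trans_lt (by exact_mod_cast (by norm_num : (2 : ℕ) < 5))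
  have h2 := congrArg Polynomial.natDegree (eq_neg_of_add_eq_zero_left h1)
  rw [Polynomial.natDegree_pow, Polynomial.natDegree_neg, hdeg] at h2
  omega

/-- ★ **THE CHART IDEAL `J₅ = (p₁, q₁)` IS PRIME AND `y₅ ∉ J₅`** (`3 ≠ 0` in `k`): it is the monic tower `(y₀² − ιG₅, y₁³ + ιH₅)` (✓ `MonicTowerPrime.isPrime_span_tower`). So `(p₁, q₁)` is saturated with
respect to `y₅`, i.e. it IS the ideal of the strict transform of `X` on the `x₅`-chart. [OURS · certificate; folklore] -/
theorem isPrime_chart5 (h3 : (3 : k) ≠ 0) (g : Fin 2 → MvPolynomial (Fin 6) k)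
    (hg0 : g 0 = X 0 ^ 2 - (X 5 * X 2 ^ 3 + C 2 * X 5 ^ 2 * X 3 ^ 4 + C 3 * X 5 ^ 3 * X 4 ^ 5 + C 4 * X 5 ^ 3))
    (hg1 : g 1 = X 1 ^ 3 + (C 2 * X 2 ^ 3 + C 3 * X 5 * X 3 ^ 4 + C 4 * X 5 ^ 2 * X 4 ^ 5 + C 5 * X 5 ^ 2)) :
    (Ideal.span (Set.range g)).IsPrime ∧ (X 5 : MvPolynomial (Fin 6) k) ∉ Ideal.span (Set.range g) := by
  obtain ⟨G, hG⟩ : ∃ G : MvPolynomial (Fin 4) k, G = X 3 * X 0 ^ 3 + C 2 * X 3 ^ 2 * X 1 ^ 4 + C 3 * X 3 ^ 3 * X 2 ^ 5 + C 4 * X 3 ^ 3 := ⟨_, rfl⟩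
  obtain ⟨H, hH⟩ : ∃ H : MvPolynomial (Fin 4) k, H = C 2 * X 0 ^ 3 + C 3 * X 3 * X 1 ^ 4 + C 4 * X 3 ^ 2 * X 2 ^ 5 + C 5 * X 3 ^ 2 := ⟨_, rfl⟩
  have hιG : MvPolynomial.eval₂Hom MvPolynomial.C ![MvPolynomial.X 2, MvPolynomial.X 3, MvPolynomial.X 4, MvPolynomial.X 5] G =
      (X 5 * X 2 ^ 3 + C 2 * X 5 ^ 2 * X 3 ^ 4 + C 3 * X 5 ^ 3 * X 4 ^ 5 + C 4 * X 5 ^ 3 : MvPolynomial (Fin 6) k) := by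
    rw [hG]
    simp only [map_add, map_mul, map_pow, MvPolynomial.eval₂Hom_X', MvPolynomial.eval₂Hom_C, Matrix.cons_val_zero, Matrix.cons_val_one, Matrix.cons_val]
  have hιH : MvPolynomial.eval₂Hom MvPolynomial.C ![MvPolynomial.X 2, MvPolynomial.X 3, MvPolynomial.X 4, MvPolynomial.X 5] H =
      (C 2 * X 2 ^ 3 + C 3 * X 5 * X 3 ^ 4 + C 4 * X 5 ^ 2 * X 4 ^ 5 + C 5 * X 5 ^ 2 : MvPolynomial (Fin 6) k) := by
    rw [hH]
    simp only [map_add, map_mul, map_pow, MvPolynomial.eval₂Hom_X', MvPolynomial.eval₂Hom_C, Matrix.cons_val_zero, Matrix.cons_val_one, Matrix.cons_val]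
  have hrange : Set.range g = {g 0, g 1} := by
    ext z
    simp only [Set.mem_range, Fin.exists_fin_two, Set.mem_insert_iff, Set.mem_singleton_iff]
    constructor
    · rintro (h | h) <;> [exact Or.inl h.symm; exact Or.inr h.symm]
    · rintro (h | h) <;> [exact Or.inl h.symm; exact Or.inr h.symm]
  have hI : Ideal.span (Set.range g) = Ideal.span {(MvPolynomial.X 0 : MvPolynomial (Fin 6) k) ^ 2 -
        MvPolynomial.eval₂Hom MvPolynomial.C ![MvPolynomial.X 2, MvPolynomial.X 3, MvPolynomial.X 4, MvPolynomial.X 5] G,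
      (MvPolynomial.X 1 : MvPolynomial (Fin 6) k) ^ 3 +
        MvPolynomial.eval₂Hom MvPolynomial.C ![MvPolynomial.X 2, MvPolynomial.X 3, MvPolynomial.X 4, MvPolynomial.X 5] H} := by
    rw [hrange, hιG, hιH, hg0, hg1]
  obtain ⟨hprime, hX⟩ := MonicTowerPrime.isPrime_span_tower k G H (no_square_G₅ k G hG) (no_cube_H₅ k h3 H hH) _ hI
  exact ⟨hprime, by simpa using hX 3⟩

/-! ## §3 The p-uniform CI Fedder certificate and the s.o.p. certificate at the chart origin -/

/-- Weighted homogeneity is preserved under subtraction (the weighted-homogeneous polynomials of a given weight form a submodule). [folklore] -/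
theorem isWeightedHomogeneous_sub {n : ℕ} {w : Fin n → ℕ} {φ ψ : MvPolynomial (Fin n) k} {m : ℕ} (h1 : IsWeightedHomogeneous w φ m)
    (h2 : IsWeightedHomogeneous w ψ m) : IsWeightedHomogeneous w (φ - ψ) m :=
  (weightedHomogeneousSubmodule k w m).sub_mem h1 h2

/-- Products of weighted-homogeneous polynomials, with the weight as an explicit numeral. [folklore] -/
theorem isWeightedHomogeneous_mul_of_eq {n : ℕ} {w : Fin n → ℕ} {φ ψ : MvPolynomial (Fin n) k} {a b D : ℕ} (h1 : IsWeightedHomogeneous w φ a)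
    (h2 : IsWeightedHomogeneous w ψ b) (e : a + b = D) : IsWeightedHomogeneous w (φ * ψ) D :=
  e ▸ h1.mul h2

/-- `yᵢ` is weighted-homogeneous of weight `wᵢ` (numeral form). [folklore] -/
theorem isWeightedHomogeneous_X' {n : ℕ} (w : Fin n → ℕ) (i : Fin n) (D : ℕ) (h : w i = D) : IsWeightedHomogeneous w (X i : MvPolynomial (Fin n) k) D :=
  h ▸ isWeightedHomogeneous_X k w i

section Fedder

variable (g : Fin 2 → MvPolynomial (Fin 6) k)
  (hg0 : g 0 = X 0 ^ 2 - (X 5 * X 2 ^ 3 + C 2 * X 5 ^ 2 * X 3 ^ 4 + C 3 * X 5 ^ 3 * X 4 ^ 5 + C 4 * X 5 ^ 3))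
  (hg1 : g 1 = X 1 ^ 3 + (C 2 * X 2 ^ 3 + C 3 * X 5 * X 3 ^ 4 + C 4 * X 5 ^ 2 * X 4 ^ 5 + C 5 * X 5 ^ 2))
include hg0 hg1

omit hg1 in
/-- `p₁ = y₀² − G₅` is weighted-homogeneous of weight `36` for `w = (18, 8, 8, 3, 0, 12)`. [folklore] -/
theorem isWeightedHomogeneous_p₁ : IsWeightedHomogeneous (![18, 8, 8, 3, 0, 12] : Fin 6 → ℕ) (g 0) 36 := by
  have hX : ∀ (i : Fin 6) (a D : ℕ), a * (![18, 8, 8, 3, 0, 12] : Fin 6 → ℕ) i = D →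
      IsWeightedHomogeneous (![18, 8, 8, 3, 0, 12] : Fin 6 → ℕ) ((X i : MvPolynomial (Fin 6) k) ^ a) D :=
    fun i a D h => DiagonalBPCIVertexNotFull.isWeightedHomogeneous_X_pow k _ i a D h
  have hX1 : ∀ (i : Fin 6) (D : ℕ), (![18, 8, 8, 3, 0, 12] : Fin 6 → ℕ) i = D → IsWeightedHomogeneous (![18, 8, 8, 3, 0, 12] : Fin 6 → ℕ) (X i : MvPolynomial (Fin 6) k) D :=
    fun i D h => isWeightedHomogeneous_X' k _ i D h
  rw [hg0]
  refine isWeightedHomogeneous_sub k (hX 0 2 36 (by decide)) ?_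
  exact (((isWeightedHomogeneous_mul_of_eq k (hX1 5 12 (by decide)) (hX 2 3 24 (by decide)) (by norm_num)).add
    (isWeightedHomogeneous_mul_of_eq k ((hX 5 2 24 (by decide)).C_mul 2) (hX 3 4 12 (by decide)) (by norm_num))).add
    (isWeightedHomogeneous_mul_of_eq k ((hX 5 3 36 (by decide)).C_mul 3) (hX 4 5 0 (by decide)) (by norm_num))).add
    ((hX 5 3 36 (by decide)).C_mul 4)

omit hg0 in
/-- `q₁ = y₁³ + H₅` is weighted-homogeneous of weight `24` for `w = (18, 8, 8, 3, 0, 12)`. [folklore] -/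
theorem isWeightedHomogeneous_q₁ : IsWeightedHomogeneous (![18, 8, 8, 3, 0, 12] : Fin 6 → ℕ) (g 1) 24 := by
  have hX : ∀ (i : Fin 6) (a D : ℕ), a * (![18, 8, 8, 3, 0, 12] : Fin 6 → ℕ) i = D →
      IsWeightedHomogeneous (![18, 8, 8, 3, 0, 12] : Fin 6 → ℕ) ((X i : MvPolynomial (Fin 6) k) ^ a) D :=
    fun i a D h => DiagonalBPCIVertexNotFull.isWeightedHomogeneous_X_pow k _ i a D h
  have hX1 : ∀ (i : Fin 6) (D : ℕ), (![18, 8, 8, 3, 0, 12] : Fin 6 → ℕ) i = D → IsWeightedHomogeneous (![18, 8, 8, 3, 0, 12] : Fin 6 → ℕ) (X i : MvPolynomial (Fin 6) k) D :=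
    fun i D h => isWeightedHomogeneous_X' k _ i D h
  rw [hg1]
  refine (hX 1 3 24 (by decide)).add ?_
  exact ((((hX 2 3 24 (by decide)).C_mul 2).add
    (isWeightedHomogeneous_mul_of_eq k ((hX1 5 12 (by decide)).C_mul 3) (hX 3 4 12 (by decide)) (by norm_num))).add
    (isWeightedHomogeneous_mul_of_eq k ((hX 5 2 24 (by decide)).C_mul 4) (hX 4 5 0 (by decide)) (by norm_num))).add
    ((hX 5 2 24 (by decide)).C_mul 5)

/-- ★ **THE p-UNIFORM CI FEDDER CERTIFICATE AT THE CHART ORIGIN**: `(p₁·q₁)^{p−1} ∈ (y₀^p, …, y₅^p)` for EVERY `p ≥ 2` — weights `(18, 8, 8, 3, 0, 12)`, `p₁q₁` of weight `60`,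
`60(p−1) > 49(p−1)`. [OURS · certificate; cite: Fedder1983, Prop. 2.1] -/
theorem prod_pow_mem_span_X_pow_chart5 (p : ℕ) (hp : 2 ≤ p) :
    (∏ l, g l) ^ (p - 1) ∈ Ideal.span (Set.range fun i : Fin 6 => (X i : MvPolynomial (Fin 6) k) ^ p) := by
  rw [Fin.prod_univ_two]
  have hw : IsWeightedHomogeneous (![18, 8, 8, 3, 0, 12] : Fin 6 → ℕ) ((g 0 * g 1) ^ (p - 1)) ((p - 1) • (36 + 24)) :=
    ((isWeightedHomogeneous_p₁ k g hg0).mul (isWeightedHomogeneous_q₁ k g hg1)).pow (p - 1)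
  refine DiagonalBPCIVertexNotFull.mem_span_X_pow_of_isWeightedHomogeneous k p _ _ _ hw ?_
  have hsum : ∑ i : Fin 6, (![18, 8, 8, 3, 0, 12] : Fin 6 → ℕ) i = 49 := by decide
  rw [hsum, smul_eq_mul]
  omega

/-- ★ **THE S.O.P. CERTIFICATE AT THE CHART ORIGIN**: `(y₀, …, y₅)⁴ ⊆ (p₁, q₁, y₂, y₃, y₄, y₅)` (`y₀² ≡ p₁`, `y₁³ ≡ q₁` modulo `(y₂, …, y₅)`). [OURS · certificate; folklore] -/
theorem sop_certificate_chart5 :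
    Ideal.span (Set.range (X : Fin 6 → MvPolynomial (Fin 6) k)) ^ 4 ≤ Ideal.ofList (List.ofFn g ++ [X 2, X 3, X 4, X 5]) := by
  set J : Ideal (MvPolynomial (Fin 6) k) := Ideal.ofList (List.ofFn g ++ [X 2, X 3, X 4, X 5]) with hJ
  have hmem : ∀ x ∈ List.ofFn g ++ [X 2, X 3, X 4, X 5], x ∈ J := fun x hx => Ideal.subset_span hx
  have hg0J : g 0 ∈ J := hmem _ (List.mem_append.mpr (Or.inl ((List.mem_ofFn' _ _).mpr ⟨0, rfl⟩)))
  have hg1J : g 1 ∈ J := hmem _ (List.mem_append.mpr (Or.inl ((List.mem_ofFn' _ _).mpr ⟨1, rfl⟩)))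
  have hX2 : (X 2 : MvPolynomial (Fin 6) k) ∈ J := hmem _ (by simp)
  have hX3 : (X 3 : MvPolynomial (Fin 6) k) ∈ J := hmem _ (by simp)
  have hX4 : (X 4 : MvPolynomial (Fin 6) k) ∈ J := hmem _ (by simp)
  have hX5 : (X 5 : MvPolynomial (Fin 6) k) ∈ J := hmem _ (by simp)
  have hX0 : (X 0 : MvPolynomial (Fin 6) k) ^ 2 ∈ J := by
    have e : (X 0 : MvPolynomial (Fin 6) k) ^ 2 = g 0 + (X 2 ^ 3 + C 2 * X 5 * X 3 ^ 4 + C 3 * X 5 ^ 2 * X 4 ^ 5 + C 4 * X 5 ^ 2) * X 5 := by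
      rw [hg0]; ring
    rw [e]
    exact add_mem hg0J (J.mul_mem_left _ hX5)
  have hX1 : (X 1 : MvPolynomial (Fin 6) k) ^ 3 ∈ J := by
    have e : (X 1 : MvPolynomial (Fin 6) k) ^ 3 = g 1 - (C 2 * X 2 ^ 2) * X 2 - (C 3 * X 3 ^ 4 + C 4 * X 5 * X 4 ^ 5 + C 5 * X 5) * X 5 := by
      rw [hg1]; ring
    rw [e]
    exact sub_mem (sub_mem hg1J (J.mul_mem_left _ hX2)) (J.mul_mem_left _ hX5)
  -- every monomial of degree 4 lies in `J`
  rw [show Ideal.span (Set.range (X : Fin 6 → MvPolynomial (Fin 6) k)) = idealOfVars (Fin 6) k from rfl, pow_idealOfVars_eq_span,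
    Ideal.span_le]
  rintro _ ⟨m, hm, rfl⟩
  rw [Set.mem_preimage, Set.mem_singleton_iff, Finsupp.degree_eq_sum, Fin.sum_univ_six] at hm
  change monomial m (1 : k) ∈ J
  by_cases h2 : 1 ≤ m 2
  · exact DiagonalBPCIVertexNotFull.monomial_mem_of_le k 2 1 m h2 (by rw [pow_one]; exact hX2)
  by_cases h3 : 1 ≤ m 3
  · exact DiagonalBPCIVertexNotFull.monomial_mem_of_le k 3 1 m h3 (by rw [pow_one]; exact hX3)
  by_cases h4 : 1 ≤ m 4
  · exact DiagonalBPCIVertexNotFull.monomial_mem_of_le k 4 1 m h4 (by rw [pow_one]; exact hX4)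
  by_cases h5 : 1 ≤ m 5
  · exact DiagonalBPCIVertexNotFull.monomial_mem_of_le k 5 1 m h5 (by rw [pow_one]; exact hX5)
  by_cases h0 : 2 ≤ m 0
  · exact DiagonalBPCIVertexNotFull.monomial_mem_of_le k 0 2 m h0 hX0
  · exact DiagonalBPCIVertexNotFull.monomial_mem_of_le k 1 3 m (by omega) hX1

end Fedder

/-! ## §4 ★★ The floor NOT-FULL column of ROW #11 -/

/-- ★★ **BED CI-1, FLOOR NOT-FULL COLUMN**: `X = V(x₀²+x₁³+x₂³+x₃⁴+x₄⁵+x₅⁵, x₀²+2x₁³+3x₂³+4x₃⁴+5x₄⁵+6x₅⁵) ⊂ 𝔸⁶`, `k` ANY field of characteristic `p` with `3 ≠ 0`, `v` the vertex: for EVERY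
blowing up `g : S′ → Spec 𝒪_{X,v}` along the point floor `𝔪̃|` there is a point `s ∈ S′` over the closed point whose local ring is NOT `FullCl p` (the origin of the `x₅`-chart
`Spec k[y]/(p₁, q₁)` of `Bl_𝔪 X`, a complete intersection failing the CI Fedder test p-UNIFORMLY). ONE application of ✓ `PointFloorNotFullCI.pointFloor_not_full`.
[OURS · census certificate (floor NOT-FULL side of ROW #11); cite: Fedder1983, Thm. 1.12 and Prop. 2.1; GortzWedhorn2020, Prop. 13.91 (2)] -/
theorem diagonalBPCI_pointFloor_not_full (p : ℕ) [Fact p.Prime] (k : Type) [Field k] [CharP k p] (h3 : (3 : k) ≠ 0)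
    (F : Fin 2 → MvPolynomial (Fin 6) k)
    (hF0 : F 0 = X 0 ^ 2 + X 1 ^ 3 + X 2 ^ 3 + X 3 ^ 4 + X 4 ^ 5 + X 5 ^ 5)
    (hF1 : F 1 = X 0 ^ 2 + C 2 * X 1 ^ 3 + C 3 * X 2 ^ 3 + C 4 * X 3 ^ 4 + C 5 * X 4 ^ 5 + C 6 * X 5 ^ 5)
    (v : Spec (.of (MvPolynomial (Fin 6) k ⧸ Ideal.span (Set.range F))))
    (hvm : v.asIdeal = Ideal.span (Set.range fun j : Fin 6 => Ideal.Quotient.mk (Ideal.span (Set.range F)) (X j)))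
    (S' : Scheme.{0}) (g' : S' ⟶ Spec ((Spec (.of (MvPolynomial (Fin 6) k ⧸ Ideal.span (Set.range F)))).presheaf.stalk v))
    (hg' : IsBlowup g' ((affineBlowup.idealSheaf (Ideal.span (Set.range fun j : Fin 6 => Ideal.Quotient.mk (Ideal.span (Set.range F)) (X j)))).comap
      ((Spec (.of (MvPolynomial (Fin 6) k ⧸ Ideal.span (Set.range F)))).fromSpecStalk v))) :
    ∃ s : S', g'.base s = closedPoint ((Spec (.of (MvPolynomial (Fin 6) k ⧸ Ideal.span (Set.range F)))).presheaf.stalk v) ∧ ¬ FullCl p (S'.presheaf.stalk s) := by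
  obtain ⟨g, hg⟩ : ∃ g : Fin 2 → MvPolynomial (Fin 6) k, g = ![X 0 ^ 2 - (X 5 * X 2 ^ 3 + C 2 * X 5 ^ 2 * X 3 ^ 4 + C 3 * X 5 ^ 3 * X 4 ^ 5 + C 4 * X 5 ^ 3),
      X 1 ^ 3 + (C 2 * X 2 ^ 3 + C 3 * X 5 * X 3 ^ 4 + C 4 * X 5 ^ 2 * X 4 ^ 5 + C 5 * X 5 ^ 2)] := ⟨_, rfl⟩
  have hg0 : g 0 = X 0 ^ 2 - (X 5 * X 2 ^ 3 + C 2 * X 5 ^ 2 * X 3 ^ 4 + C 3 * X 5 ^ 3 * X 4 ^ 5 + C 4 * X 5 ^ 3) := by rw [hg]; rfl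
  have hg1 : g 1 = X 1 ^ 3 + (C 2 * X 2 ^ 3 + C 3 * X 5 * X 3 ^ 4 + C 4 * X 5 ^ 2 * X 4 ^ 5 + C 5 * X 5 ^ 2) := by rw [hg]; rfl
  obtain ⟨hJ, hX5⟩ := isPrime_chart5 k h3 g hg0 hg1
  exact PointFloorNotFullCI.pointFloor_not_full p k F (DiagonalBPCIVertexNotFull.constantCoeff_F k F hF0 hF1) 5 ![C 2 * F 0 - F 1, F 1 - F 0]
    (PQ_mem k F) g ![2, 3] (theta_PQ k F hF0 hF1 g hg0 hg1) (theta_F_mem k F hF0 hF1 g hg0 hg1) hJ hX5 (constantCoeff_g k g hg0 hg1)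
    (prod_pow_mem_span_X_pow_chart5 k g hg0 hg1 p (Fact.out : p.Prime).two_le) [X 2, X 3, X 4, X 5] (by simp [constantCoeff_X]) rfl 4
    (sop_certificate_chart5 k g hg0 hg1) v hvm S' g' hg'

end Summit.ResolutionOfSingularities.ResolutionOfSingularities.Theorems.FInjectiveMacaulayfication.DiagonalBPCIChart5NotFull

end
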